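import Mathlib
import Summits.KontsevichZagierPeriods.Zeta5Search.Elimination.QBoundaryTwoTerm
import Summits.KontsevichZagierPeriods.Zeta5Search.WedgeDictionaryWideSteps
import Summits.KontsevichZagierPeriods.Zeta5Search.LeadingCoefficientVanishing
import HarnessLib

/-!
# The boundary two-term law for `Q` on the whole WIDE region (cell `pub-zeta5`, ct-1 g24)

HONEST FRAMING: systematic search; no irrationality claim unless certified.  Identities among Brown–Zudilin's leading
coefficient `Q(a)` ([BrownZudilin2022, (17)], `QOf`) at two neighbouring parameter vectors and the cell's rational dictionary data;
no integral is evaluated, nothing about sizes, denominators or ζ(5); records in print UNMOVED.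

OUR work (Summit side; seat `pub-zeta5-ct-1` generation 24, 2026-08-26).  fam-elim E-L31 (`Elimination/QBoundaryTwoTerm`,
`qTwoTerm_boundary`) proved gen-1's STAR relation with a ZERO slot as pivot — the two-term law
  `b_i·(b₀ + 1 − b_i)·Q(a) + fanCoeff(b, i)·Q(a − s_i) = 0`     (`b = b(a)`, `b_m = 0`, `b_i ≥ 1`, `i ≠ m`)
— on gen-1's REGION (`RegionHyp`: the half box `2b_k ≤ b₀ + 1`).  Its ingredients are box-wide: the gauge-free relation
`two_wedge` (any box point with `d ≥ 0`, slots `≤ b₀`), the slot-step gauge `rhoB_lower` and the polynomial identity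
`starPi_gauge`; only the dictionary values `Q = ρ·(U∧W)` were taken from `dict_values` (half box).  With ct-1 g22's
`dict_values_wide` (from `qPart_wide`: `Q = ρ·M₃` at EVERY convergent `a` with `b(a) ≥ 0`, `d ≥ 0`) the same assembly gives the
law on the whole wide region:

* `qTwoTerm_boundary_wide` — for convergent `a` with `b(a) ≥ 0`, `d(b(a)) ≥ 0`, a zero slot `b_m = 0` and a slot `i ≠ m` with
  `b_i ≥ 1`: `b_i(b₀+1−b_i)·Q(a) + fanCoeff(b,i)·Q(a − s_i) = 0`;
* `qTwoTerm_boundary_wide'` — the same with the hypothesis `b_i ≥ 1` dropped (for `b_i = 0` the first coefficient vanishes and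
  `a − s_i` has a negative slot, so `Q(a − s_i) = 0` by ct-1 g24's `QOf_eq_zero_of_slot_neg`);
* `dictPencil_Q_of_ghost_base` — the same identity read as gen-1's PENCIL relation in slot `i` based at the GHOST point
  `x = a − DS` (some slot of `x` equal to `−1`, so `Q(x) = 0`): `pencilApex(b(x), i)·Q(a) + fanCoeff(b(a), i)·Q(a − s_i) = 0`.
Exact check before formalisation (seat folder `code/laws.py`): all 63 035 instances `(a, i)` with `b(a)` of level `≤ 5`, 0 failures.
Use (ct-1 g24): the `Q`-side of the slot-2 PENCIL steps across the boundary of the wide region in the proof of Brown–Zudilin's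
decomposition (4) on the whole convergence cone.
-/

open Finset

namespace Summit.KontsevichZagierPeriods.Zeta5Search.Elimination

open Summit.KontsevichZagierPeriods.Zeta5Search.DualSeries (InBox)
open Summit.KontsevichZagierPeriods.Zeta5Search.WedgeDictionary
open Summit.KontsevichZagierPeriods.Zeta5Search.SymmetricGauge
open Literature.NumberTheory.Irrationality.BrownZudilin2022 (bOfA Converges QOf)
open Summit.KontsevichZagierPeriods.Zeta5Search.WedgeDictionaryWideSteps (wide_add_slotDown)
open Summit.KontsevichZagierPeriods.Zeta5Search.WedgeDictionaryDictStarWide (dict_values_wide)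

/-- **THE BOUNDARY TWO-TERM LAW FOR `Q` ON THE WIDE REGION.**  For a convergent `a` with `b(a) ≥ 0` and `d(b(a)) ≥ 0`, slots
`i ≠ m` in `[1,7]` with `b(a)_m = 0` and `b(a)_i ≥ 1`:
`b_i·(b₀ + 1 − b_i)·Q(a) + fanCoeff(b, i)·Q(a − s_i) = 0` (`b = b(a)`) — E-L31's `qTwoTerm_boundary` with ct-1 g22's
`dict_values_wide` in place of `dict_values`. -/
theorem qTwoTerm_boundary_wide (a : Fin 8 → ℤ) {i m : ℕ} (hconv : Converges a) (hnn : ∀ n ∈ Icc 1 7, 0 ≤ bOfA a n)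
    (hd0 : 0 ≤ dOf (bOfA a)) (hi : i ∈ Icc 1 7) (hm : m ∈ Icc 1 7) (him : i ≠ m) (hm0 : bOfA a m = 0)
    (hi1 : 1 ≤ bOfA a i) :
    bOfA a i * (bOfA a 0 + 1 - bOfA a i) * QOf a + fanCoeff (bOfA a) i * QOf (a + slotDown i) = 0 := by
  obtain ⟨hi1', hi7⟩ := mem_Icc.1 hi
  obtain ⟨hconv2, hnn2, hd2⟩ := wide_add_slotDown hi hconv hnn hd0 hi1
  obtain ⟨hQ0, -, -⟩ := dict_values_wide hi hconv hnn hd0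
  obtain ⟨hQ2, -, -⟩ := dict_values_wide hi hconv2 hnn2 hd2
  obtain ⟨hPI, hle⟩ := inBox_of_full a hconv hnn
  have hE : ∀ jk ∈ Epairs, bOfA a jk.1 + bOfA a jk.2 ≤ bOfA a 0 := epairs_le_of_converges a hconv
  -- (1) the gauge-free two-term relation at `(P; i)`, zero pivot `m`
  have W := two_wedge (bOfA a) hi hm him hPI hd0 hle hi1 hm0
  unfold TwoW at W
  -- (2) the gauge of the slot step `P ↦ P − e_i` and (3) the polynomial identity at slot `i`
  obtain ⟨si, rfl⟩ : ∃ s, i = s + 1 := ⟨i - 1, by omega⟩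
  have Gi : rhoB (lowerAt (bOfA a) (si + 1)) * ((dOf (bOfA a) : ℚ) + 1) * (chiOf (bOfA a) (si + 1) : ℚ) =
      -((bOfA a (si + 1) : ℚ) * edgeProd (bOfA a) (si + 1) * rhoB (bOfA a)) :=
    rhoB_lower (bOfA a) (show si < 7 by omega) hPI hi1 hd0 hE
  have Si := starPi_gauge (bOfA a) hi
  -- non-vanishing
  have hd : ((dOf (bOfA a) : ℚ) + 1) ≠ 0 := by
    have : (0 : ℚ) ≤ dOf (bOfA a) := by exact_mod_cast hd0
    exact ne_of_gt (by linarith)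
  have hχ : (chiOf (bOfA a) (si + 1) : ℚ) ≠ 0 := by
    have h1 : (1 : ℤ) ≤ chiOf (bOfA a) (si + 1) := by
      unfold chiOf; split_ifs
      · omega
      · exact le_refl _
    have : (1 : ℚ) ≤ chiOf (bOfA a) (si + 1) := by exact_mod_cast h1
    exact ne_of_gt (by linarith)
  -- the lowered point is `P − e_i`
  have hQi : ∀ n, n ≤ 7 → bOfA (a + slotDown (si + 1)) n = lowerAt (bOfA a) (si + 1) n := fun n hn => by
    rw [bOfA_add_slotDown _ _ hi n hn, lowerAt_apply]
    split_ifs with h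
    · rw [h]
    · rfl
  rw [rhoOf_eq_rhoB] at hQ0 hQ2
  rw [rhoB_congr hQi, (cas_congr hQi).1] at hQ2
  have hq : ((bOfA a (si + 1) : ℚ) * ((bOfA a 0 : ℚ) + 1 - bOfA a (si + 1))) * (QOf a : ℚ) +
      (fanCoeff (bOfA a) (si + 1) : ℚ) * (QOf (a + slotDown (si + 1)) : ℚ) = 0 := by
    rw [hQ0, hQ2]
    exact twoTop_assemble W Gi Si hd hχ
  exact_mod_cast hq

/-- The law with the hypothesis `b_i ≥ 1` dropped: if `b_i = 0` the first coefficient vanishes and `a − s_i` has the negative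
slot `b_i − 1 = −1`, where `Q = 0` (`QOf_eq_zero_of_slot_neg`). -/
theorem qTwoTerm_boundary_wide' (a : Fin 8 → ℤ) {i m : ℕ} (hconv : Converges a) (hnn : ∀ n ∈ Icc 1 7, 0 ≤ bOfA a n)
    (hd0 : 0 ≤ dOf (bOfA a)) (hi : i ∈ Icc 1 7) (hm : m ∈ Icc 1 7) (him : i ≠ m) (hm0 : bOfA a m = 0) :
    bOfA a i * (bOfA a 0 + 1 - bOfA a i) * QOf a + fanCoeff (bOfA a) i * QOf (a + slotDown i) = 0 := by
  by_cases hi1 : 1 ≤ bOfA a i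
  · exact qTwoTerm_boundary_wide a hconv hnn hd0 hi hm him hm0 hi1
  · have hi0 : bOfA a i = 0 := le_antisymm (by omega) (hnn i hi)
    have hneg : bOfA (a + slotDown i) i < 0 := by
      rw [bOfA_add_slotDown a i hi i (mem_Icc.1 hi).2, if_pos rfl, hi0]; norm_num
    rw [QOf_eq_zero_of_slot_neg (a + slotDown i) hi hneg, hi0]
    ring

/-- `b(x + DS)` has the zero slot `m` iff `b(x)_m = −1`; bookkeeping for the ghost-base reading. -/
theorem bOfA_dsUp_slot (x : Fin 8 → ℤ) {n : ℕ} (hn : n ∈ Icc 1 7) : bOfA (x + dsUp) n = bOfA x n + 1 := by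
  obtain ⟨h1, h7⟩ := mem_Icc.1 hn
  rw [bOfA_add_dsUp x n h7, if_neg (by omega)]

/-- `b(x + DS)₀ = b(x)₀ + 2`. -/
theorem bOfA_dsUp_zero (x : Fin 8 → ℤ) : bOfA (x + dsUp) 0 = bOfA x 0 + 2 := by
  rw [bOfA_add_dsUp x 0 (by norm_num), if_pos rfl]

/-- **The PENCIL relation for `Q` based at a GHOST point.**  Let `x` have a slot `b(x)_m = −1` (so `Q(x) = 0`) and let the apex
`a = x + DS` be convergent with `b(a) ≥ 0`, `d(b(a)) ≥ 0`.  Then for every slot `i ≠ m`, gen-1's PENCIL relation in slot `i`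
`pencilBase(b(x))·Q(x) + pencilApex(b(x), i)·Q(x + DS) + fanCoeff(b(x + DS), i)·Q(x + DS − s_i) = 0` holds — it is the
boundary two-term law at the apex, since `pencilApex(b(x), i) = b(a)_i·(b(a)₀ + 1 − b(a)_i)`. -/
theorem dictPencil_Q_of_ghost_base (x : Fin 8 → ℤ) {i m : ℕ} (hi : i ∈ Icc 1 7) (hm : m ∈ Icc 1 7) (him : i ≠ m)
    (hxm : bOfA x m = -1) (hconv : Converges (x + dsUp)) (hnn : ∀ n ∈ Icc 1 7, 0 ≤ bOfA (x + dsUp) n)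
    (hd0 : 0 ≤ dOf (bOfA (x + dsUp))) :
    (pencilBase (bOfA x) : ℚ) * (QOf x : ℚ) + (pencilApex (bOfA x) i : ℚ) * (QOf (x + dsUp) : ℚ) +
      (fanCoeff (bOfA (x + dsUp)) i : ℚ) * (QOf (x + dsUp + slotDown i) : ℚ) = 0 := by
  have hQx : QOf x = 0 := QOf_eq_zero_of_slot_neg x hm (by rw [hxm]; norm_num)
  have hm0 : bOfA (x + dsUp) m = 0 := by rw [bOfA_dsUp_slot x hm, hxm]; norm_num
  have key := qTwoTerm_boundary_wide' (x + dsUp) hconv hnn hd0 hi hm him hm0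
  have hapex : pencilApex (bOfA x) i = bOfA (x + dsUp) i * (bOfA (x + dsUp) 0 + 1 - bOfA (x + dsUp) i) := by
    unfold pencilApex
    rw [bOfA_dsUp_slot x hi, bOfA_dsUp_zero]
    ring
  rw [hQx, hapex]
  push_cast
  have key' : ((bOfA (x + dsUp) i * (bOfA (x + dsUp) 0 + 1 - bOfA (x + dsUp) i) * QOf (x + dsUp) +
      fanCoeff (bOfA (x + dsUp)) i * QOf (x + dsUp + slotDown i) : ℤ) : ℚ) = 0 := by
    exact_mod_cast key
  push_cast at key'
  linear_combination key'

end Summit.KontsevichZagierPeriods.Zeta5Search.Elimination
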